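import Mathlib.Analysis.SpecialFunctions.Pow.Real
import HarnessLib

/-!
# Lemmas for the stub `pointDatum_or_smallLowSurface3_of` of line `orbit-interpolation-determinant` (crux `ApproximationProperty`, stmt-Schanuel-6117)

Route `DiophantineDichotomy` (sub-problem `Schanuel/Schanuel`), crux
`Summit.Schanuel.Schanuel.Theses.DiophantineDichotomy.ApproximationProperty` (stmt-Schanuel-6117), line
`orbit-interpolation-determinant`, skeleton v27 (lead `prover-line-stmt-Schanuel-6117-c13-0`). Real-arithmetic
helper lemmas of the SMALLNESS SPLITTING of the low-surface form (assembled in `…SmallLowSurfaceOr.lean`, registered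
stub `pointDatum_or_smallLowSurface3_of`):

* `liouville_exponent_lt'` — the exponent of Nesterenko's Prop. 4.11 (`r = 1`) is beaten by the orbit's smallness,
  for a form of height `≤ 2Y/c₁` (variant of the landed `HighSatellite.liouville_exponent_lt`);
* `smallLowSurface_half_rate_le` (registered sub-goal), `rateB_le` — bookkeeping of the halved Dirichlet rate (case A)
  and of the per-degree rate `κ²Δ²Y/(400c₁)` of the prime factors (case B);
* `prod_part_le` — if `g·q ≤ e^{−R}·G·P` and `g > e^{−R/2}G` then `q ≤ e^{−R/2}P`;
* `exists_le_exp_mul` — weighted pigeonhole: `∏ xᵢ ≤ e^{−S} ∏ Mᵢ` and `∑ aᵢ ε ≤ S` give an `i` with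
  `xᵢ ≤ e^{−aᵢε} Mᵢ`;
* `exp_neg_le_of_one_le` — `1 ≤ eᵗAB ⇒ e^{−t} ≤ AB`.

Proofs only, no definitions. Sources: folklore.
-/

set_option linter.dupNamespace false

noncomputable section

namespace Summit.Schanuel.Schanuel.Cruxes.ApproximationProperty.OrbitInterpolationDeterminant

open Real
open scoped BigOperators

namespace SmallLowSurface

/-! ## Arithmetic of the smallness splitting -/

/-- **The Liouville exponent is beaten by the orbit's smallness** (variant of `HighSatellite.liouville_exponent_lt`
with `h(g) ≤ 2Y/c₁`): with `deg g ≤ Δ/(32c₁)`, `Y ≥ Δ > 0`, `D ≥ 1`, `h ≥ 0`: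
`h(g)D + h·deg g + 99 D deg g − (Δh + 8YD)/c₁ < 0`. [folklore] -/
theorem liouville_exponent_lt' {c₁ Δ Y D h hg dg : ℝ} (hc₁ : 1 ≤ c₁) (hΔ : 0 < Δ) (hΔY : Δ ≤ Y)
    (hD : 1 ≤ D) (hh : 0 ≤ h) (hdg : dg ≤ Δ / (32 * c₁)) (hhg : hg ≤ 2 * Y / c₁) :
    -((Δ * h + 8 * Y * D) / c₁) + (hg * D + h * dg + 11 * (3 : ℝ) ^ 2 * D * dg) < 0 := by
  have hc₁0 : 0 < c₁ := by linarith
  have e1 : hg * D ≤ 2 * Y / c₁ * D := mul_le_mul_of_nonneg_right hhg (by linarith)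
  have e2 : h * dg ≤ h * (Δ / (32 * c₁)) := mul_le_mul_of_nonneg_left hdg hh
  have e3 : 11 * (3 : ℝ) ^ 2 * D * dg ≤ 11 * (3 : ℝ) ^ 2 * D * (Δ / (32 * c₁)) :=
    mul_le_mul_of_nonneg_left hdg (by positivity)
  have e4 : 11 * (3 : ℝ) ^ 2 * D * (Δ / (32 * c₁)) ≤ 4 * Y * D / c₁ := by
    rw [show 11 * (3 : ℝ) ^ 2 * D * (Δ / (32 * c₁)) = (99 / 32) * (Δ * D) / c₁ by ring]
    rw [div_le_div_iff_of_pos_right hc₁0]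
    nlinarith [mul_le_mul_of_nonneg_right hΔY (by linarith : (0 : ℝ) ≤ D)]
  have e5 : h * (Δ / (32 * c₁)) ≤ Δ * h / c₁ := by
    rw [show h * (Δ / (32 * c₁)) = (Δ * h / c₁) * (1 / 32) by ring]
    have : 0 ≤ Δ * h / c₁ := by positivity
    nlinarith
  have e6 : 0 < Y * D / c₁ := by
    have : 0 < Y := by linarith
    positivity
  have key : hg * D + h * dg + 11 * (3 : ℝ) ^ 2 * D * dg ≤
      2 * Y / c₁ * D + Δ * h / c₁ + 4 * Y * D / c₁ := by
    linarith
  have : 2 * Y / c₁ * D + Δ * h / c₁ + 4 * Y * D / c₁ < (Δ * h + 8 * Y * D) / c₁ := by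
    rw [show (Δ * h + 8 * Y * D) / c₁ = Δ * h / c₁ + 8 * (Y * D / c₁) by ring,
      show 2 * Y / c₁ * D = 2 * (Y * D / c₁) by ring,
      show 4 * Y * D / c₁ = 4 * (Y * D / c₁) by ring]
    linarith
  linarith

end SmallLowSurface

/-- **Registered sub-goal `smallLowSurface_half_rate_le`** (crux `stmt-Schanuel-6117`, line `orbit-interpolation-determinant`,
skeleton v27; the halved Dirichlet rate of case A of the smallness splitting): with `R = ((C−4)/2)L − c_B(d₁+1) − 4d₁`,
`(C−4)/2 ≥ r₀Δ³ − 2`, `L ≥ 0`, `c_B ≥ 0`, `0 ≤ d₁ ≤ κΔ`: `−R/2 ≤ (c_B+1)(2κΔ+1) − ((r₀/2)Δ³ − 2)L`. [folklore] -/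
theorem smallLowSurface_half_rate_le : ∀ {C L cB d₁ κ Δ r₀ : ℝ}, r₀ * Δ ^ 3 - 2 ≤ (C - 4) / 2 → 0 ≤ L → 0 ≤ cB → 0 ≤ d₁ → d₁ ≤ κ * Δ → -(((C - 4) / 2 * L - cB * (d₁ + 1) - 4 * d₁) / 2) ≤ (cB + 1) * (2 * κ * Δ + 1) - (r₀ / 2 * Δ ^ 3 - 2) * L := by
  intro C L cB d₁ κ Δ r₀ hrate hL0 hcB hd₁0 hd₁le
  have e1 : (r₀ * Δ ^ 3 - 2) * L ≤ (C - 4) / 2 * L := mul_le_mul_of_nonneg_right hrate hL0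
  have e2 : cB * d₁ ≤ cB * (κ * Δ) := mul_le_mul_of_nonneg_left hd₁le hcB
  have e3 : 0 ≤ cB * d₁ := mul_nonneg hcB hd₁0
  linarith

namespace SmallLowSurface

/-- **Rate of case B of the splitting**: with `(C−4)/2 ≥ κ³Δ³/96 − 2`, `L ≥ Y/c₁`, `d₁ ≤ κΔ`, `κΔ ≥ 10`,
`κ²Δ ≥ 800c₁(c_B+2)`, `Y ≥ Δ ≥ c₁ ≥ 1`: `κ³Δ³Y/(200c₁) ≤ ((C−4)/2)L − c_B(d₁+1) − 4d₁`. [folklore] -/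
theorem rateB_le {C L cB d₁ κ Δ Y c₁ r₀ : ℝ} (hc₁ : 1 ≤ c₁) (hcB : 0 < cB) (hκ0 : 0 < κ)
    (hκΔ : 10 ≤ κ * Δ) (hthr : 800 * c₁ * (cB + 2) / κ ^ 2 ≤ Δ) (hc₁Δ : c₁ ≤ Δ) (hΔY : Δ ≤ Y)
    (hL : Y / c₁ ≤ L) (hr₀ : r₀ = κ ^ 3 / 96) (hrate : r₀ * Δ ^ 3 - 2 ≤ (C - 4) / 2)
    (hd₁le : d₁ ≤ κ * Δ) :
    κ ^ 3 * Δ ^ 3 * Y / (200 * c₁) ≤ (C - 4) / 2 * L - cB * (d₁ + 1) - 4 * d₁ := by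
  subst hr₀
  have hc₁0 : 0 < c₁ := by linarith
  have hΔ0 : 0 < Δ := by linarith
  have hY0 : 0 < Y := by linarith
  have hΔ1 : 1 ≤ Δ := hc₁.trans hc₁Δ
  have hY1 : 1 ≤ Y / c₁ := by rw [le_div_iff₀ hc₁0]; linarith
  have hL0 : 0 ≤ L := by linarith
  -- `u = κΔ ≥ 10`
  have hu3 : (10 : ℝ) ^ 3 ≤ (κ * Δ) ^ 3 := pow_le_pow_left₀ (by norm_num) hκΔ 3
  have hpos : 0 ≤ κ ^ 3 / 96 * Δ ^ 3 - 2 := by nlinarith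
  have e1a : (κ ^ 3 / 96 * Δ ^ 3 - 2) * (Y / c₁) ≤ (κ ^ 3 / 96 * Δ ^ 3 - 2) * L :=
    mul_le_mul_of_nonneg_left hL hpos
  have e1b : (κ ^ 3 / 96 * Δ ^ 3 - 2) * L ≤ (C - 4) / 2 * L := mul_le_mul_of_nonneg_right hrate hL0
  have e2 : cB * d₁ ≤ cB * (κ * Δ) := mul_le_mul_of_nonneg_left hd₁le hcB.le
  have e4 : cB * 10 ≤ cB * (κ * Δ) := mul_le_mul_of_nonneg_left hκΔ hcB.le
  -- (a) `2Y/c₁` against `(κΔ)³ (Y/c₁)`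
  have ea : 1000 * (Y / c₁) ≤ (κ * Δ) ^ 3 * (Y / c₁) :=
    mul_le_mul_of_nonneg_right (by nlinarith) (by positivity)
  -- (b) `c_B(κΔ+1) + 4κΔ` against `(κΔ)³ (Y/c₁)`
  have hb1 : 800 * c₁ * (cB + 2) ≤ κ ^ 2 * Δ := by
    have := (div_le_iff₀ (by positivity : (0 : ℝ) < κ ^ 2)).mp hthr
    linarith
  have hb2 : 800 * (cB + 2) ≤ κ ^ 2 * Δ := by
    have := mul_le_mul_of_nonneg_right hc₁ (by positivity : (0 : ℝ) ≤ 800 * (cB + 2))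
    linarith
  have hb3 : 1 ≤ Δ * (Y / c₁) := one_le_mul_of_one_le_of_one_le hΔ1 hY1
  have eb : 800 * (cB + 2) * 1 ≤ κ ^ 2 * Δ * (Δ * (Y / c₁)) :=
    mul_le_mul hb2 hb3 zero_le_one (by positivity)
  have eb' : 800 * (cB + 2) * 1 * (κ * Δ) ≤ κ ^ 2 * Δ * (Δ * (Y / c₁)) * (κ * Δ) :=
    mul_le_mul_of_nonneg_right eb (by positivity)
  rw [show κ ^ 3 * Δ ^ 3 * Y / (200 * c₁) = (κ * Δ) ^ 3 * (Y / c₁) / 200 by ring]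
  linarith

/-! ## Two generic real lemmas: the product part, and the weighted pigeonhole -/

/-- **The product part carries half of the smallness**: if `g·q ≤ e^{−R}·(G·P)` with `G, P > 0` and
`g > e^{−R/2} G`, then `q ≤ e^{−R/2} P`. [folklore] -/
theorem prod_part_le {g q G P R : ℝ} (hG : 0 < G) (hP : 0 < P) (hkey : g * q ≤ Real.exp (-R) * (G * P))
    (hA : Real.exp (-(R / 2)) * G < g) : q ≤ Real.exp (-(R / 2)) * P := by
  by_contra hcon
  push Not at hcon
  have h1 := mul_lt_mul'' hA hcon (by positivity) (by positivity)
  have he : Real.exp (-R) = Real.exp (-(R / 2)) * Real.exp (-(R / 2)) := by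
    rw [← Real.exp_add]
    congr 1
    ring
  rw [he] at hkey
  linarith

/-- **Weighted pigeonhole**: for `k ≥ 1`, `Mᵢ > 0`, `∏ xᵢ ≤ e^{−S} ∏ Mᵢ` and `(∑ aᵢ) ε ≤ S`, some `i` has
`xᵢ ≤ e^{−aᵢ ε} Mᵢ`. [folklore] -/
theorem exists_le_exp_mul {k : ℕ} (hk : 1 ≤ k) {x M a : Fin k → ℝ} {ε S : ℝ} (hM : ∀ i, 0 < M i)
    (hprod : ∏ i, x i ≤ Real.exp (-S) * ∏ i, M i) (hsum : (∑ i, a i) * ε ≤ S) :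
    ∃ i, x i ≤ Real.exp (-(a i * ε)) * M i := by
  by_contra hall
  push Not at hall
  have hne : (Finset.univ : Finset (Fin k)).Nonempty := ⟨⟨0, hk⟩, Finset.mem_univ _⟩
  have hMP : 0 < ∏ i, M i := Finset.prod_pos fun i _ => hM i
  have hlt : ∏ i, Real.exp (-(a i * ε)) * M i < ∏ i, x i :=
    Finset.prod_lt_prod_of_nonempty (fun i _ => mul_pos (Real.exp_pos _) (hM i)) (fun i _ => hall i) hne
  have heq : ∏ i, Real.exp (-(a i * ε)) * M i = Real.exp (-((∑ i, a i) * ε)) * ∏ i, M i := by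
    rw [Finset.prod_mul_distrib, Finset.sum_mul, ← Finset.sum_neg_distrib, Real.exp_sum]
  have hge : Real.exp (-S) * ∏ i, M i ≤ Real.exp (-((∑ i, a i) * ε)) * ∏ i, M i :=
    mul_le_mul_of_nonneg_right (Real.exp_le_exp.mpr (by linarith)) hMP.le
  rw [heq] at hlt
  linarith

/-- `1 ≤ eᵗ·A·B ⇒ e^{−t} ≤ A·B`. [folklore] -/
theorem exp_neg_le_of_one_le {t A B : ℝ} (h : 1 ≤ Real.exp t * A * B) : Real.exp (-t) ≤ A * B := by
  have he : Real.exp (-t) * (Real.exp t * A * B) = A * B := by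
    rw [Real.exp_neg]
    field_simp
  calc Real.exp (-t) = Real.exp (-t) * 1 := (mul_one _).symm
    _ ≤ Real.exp (-t) * (Real.exp t * A * B) := mul_le_mul_of_nonneg_left h (Real.exp_pos _).le
    _ = A * B := he

end SmallLowSurface

end Summit.Schanuel.Schanuel.Cruxes.ApproximationProperty.OrbitInterpolationDeterminant

end
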